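import Literature.Analysis.FluidPDE.PassiveVectorLionsExistence
import HarnessLib

/-!
# Registered stub `stub_existence` (V1) of support item `CascadeBookkeeping`
(route `AnomalousDissipation/SolenoidalFractalHomogenisation`, item stmt-AnomalousDissipation-19074, skeleton
`energy-road` registered 2026-08-27 by seat ad-solenoidal-cb-p1; cell ad-ideate)

**A0 weak existence** — for `ν > 0`, a (jointly continuous) carrier `b` with bounded space–time lift on
`(0,1) × T³`, weakly divergence free at every time, and an `H¹ ∩ L²` mean-zero weakly divergence-free datum `w₀`,
a weak solution `Torus.IsWeakPassiveVectorOn 0 1 ν b w₀ w` of the passive solenoidal vector equation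
(`∂ₜw + (b·∇)w + ∇π = νΔw`, `∇·w = 0`, `w(0) = w₀`) exists. This is the special case `T = 1`, `d = 3` of the
Literature existence theorem `Torus.exists_isWeakPassiveVectorOn` (`PassiveVectorLionsExistence`: J.-L. Lions'
Hilbert-space theorem on the closed span of the divergence-free tests, undamping, and the Galerkin `L^∞_t L²_x`
bound); only boundedness of the carrier, a.e. weak incompressibility of the carrier, and `w₀ ∈ L²` weakly
divergence free are used. With the landed `stub_lowerEnergy` (p535182) and the composition
`cascadeBookkeeping_of_exists_of_lowerEnergy` (p528227) this closes `CascadeBookkeeping`. (Route-independent file: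
no Theses import.)
-/

set_option linter.dupNamespace false

noncomputable section

namespace Summit.AnomalousDissipation.AnomalousDissipation.Theorems.SolenoidalFractalHomogenisation.CascadeBookkeeping

open Set MeasureTheory Function
open scoped ENNReal
open Literature.Analysis.FunctionSpaces Literature.Analysis.FunctionSpaces.Torus Literature.Analysis.FluidPDE.Torus

/-- **Registered stub `stub_existence` (V1) of `CascadeBookkeeping`**: existence of an A0 weak solution
`IsWeakPassiveVectorOn 0 1 ν b w₀ w` for `ν > 0`, a continuous carrier bounded on `(0,1) × T³` and weakly
divergence free at every time, and an `H¹ ∩ L²` mean-zero weakly divergence-free datum — by J.-L. Lions' theorem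
(`Torus.exists_isWeakPassiveVectorOn`). [cite: LionsMagenes1972, Chap. 3 Thm. 1.1] -/
theorem stub_existence : ∀ ν : ℝ, 0 < ν → ∀ b : ℝ → UnitAddTorus (Fin 3) → EuclideanSpace ℝ (Fin 3),
    Continuous (uncurry b) →
    MemLp (stLift b) ∞ (volume.restrict (Ioo 0 1 ×ˢ (univ : Set (EuclideanSpace ℝ (Fin 3))))) →
    (∀ t, IsWeaklyDivFree (b t)) →
    ∀ w₀ : UnitAddTorus (Fin 3) → EuclideanSpace ℝ (Fin 3),
    MemSobolev 1 (EuclideanSpace.complexify ∘ w₀) → MemLp w₀ 2 volume → HasZeroMean w₀ →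
    IsWeaklyDivFree w₀ →
    ∃ w, IsWeakPassiveVectorOn 0 1 ν b w₀ w := by
  intro ν hν b _ hb hbdiv w₀ _ hw₀ _ hdiv
  exact exists_isWeakPassiveVectorOn one_pos hν hb (ae_of_all _ fun t => hbdiv t) hw₀ hdiv

end Summit.AnomalousDissipation.AnomalousDissipation.Theorems.SolenoidalFractalHomogenisation.CascadeBookkeeping

end
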